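import Literature.NumberTheory.Automorphic.ModularFunctionOrbitPolynomial
import Literature.NumberTheory.Automorphic.GaloisConjugateLocalRoots
import Literature.NumberTheory.ModularForms.QExpansionAlgebra
import Literature.Analysis.Complex.AnalyticRootSystems
import Literature.Analysis.Complex.AlgebraicFunctionContinuation
import Mathlib.Analysis.SpecialFunctions.Complex.LogDeriv
import HarnessLib

/-!
# Galois conjugation of modular functions, II: the conjugate roots as functions on `ℍ`

Second file of the analytic proof of the Galois-conjugation input of Calegari–Dimitrov–Tang,
*The unbounded denominators conjecture* (J. Amer. Math. Soc. **38** (2025), arXiv:2109.09040),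
Remark 59 ("the absolute Galois group acts on the `q`-expansions of modular forms", used for
noncongruence subgroups). Set-up as in `GaloisConjugateLocalRoots.lean`: a nonempty finite set
`O` of holomorphic functions on `ℍ`, its orbit polynomial `𝒫 ∈ ℂ[X][Y]`
(`𝒫(λ(τ), Y) = (λ(τ)(1 − λ(τ)))^M ∏_{Φ ∈ O} (Y − Φ(τ))`), a field automorphism `σ` of `ℂ` and
`𝒬 = 𝒫^σ`. Assume moreover that everything is `L`-periodic, that `s` is a nowhere vanishing
`L`-periodic holomorphic function with RATIONAL `q`-expansion such that every `Φ·s` (`Φ ∈ O`) is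
bounded at `i∞`, and that `λ` is `L`-periodic with rational expansion.

**Main theorem** (`exists_conjugate_roots`). There are holomorphic functions `G'_Φ` (`Φ ∈ O`) on
`ℍ` with `G'_Φ · s` bounded at `i∞`,
`qExpansion L (G'_Φ · s) = σ (qExpansion L (Φ · s))` (`σ` applied coefficientwise), and
`𝒬(λ(τ), Y) = (λ(τ)(1 − λ(τ)))^M ∏_{Φ ∈ O} (Y − G'_Φ(τ))` for all `τ ∈ ℍ`.
So the conjugate polynomial has a complete set of holomorphic roots on `ℍ` whose expansions at
`i∞` are the conjugates of the expansions of the original roots.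

Proof. Scale the roots by `s` and pass to the `q_L`-disc: the monic polynomial
`∏ (Y − Φ s)` has coefficients whose expansions `Eₙ` satisfy `D·Eₙ = S^{d−n} 𝒫ₙ(Λ)` in `ℂ⟦q⟧`
(`Λ, S, D` the expansions of `λ, s, (λ(1−λ))^M`); applying `σ` gives `D·E'ₙ = S^{d−n} 𝒬ₙ(Λ)`
(rationality of `Λ, S`), so by holomorphic division
(`FormalRoot.exists_eq_mul_of_taylor_eq_mul`) the `E'ₙ` are Taylor series of holomorphic
functions `βₙ` on the disc, `βₙ = (cusp function of s^{d−n} 𝒬ₙ(λ)) / (cusp function of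
(λ(1−λ))^M)` off `0`. The polynomial `Σ βₙ(q) Yⁿ` has the formal factorization
`∏ (Y − σΨ_Φ)` (`Ψ_Φ` the expansion of `Φ s`) at `q = 0` with distinct formal roots, hence a
local holomorphic root system there (`FormalRoot.exists_local_roots_of_taylor_factorization`),
and local holomorphic root systems at every other point of the disc by
`exists_local_roots_conjugate` (part I) transported along a local inverse of `𝕢_L`; the roots
continue to the whole disc (`RootContinuation.exists_holomorphic_root_extend`), factor the
polynomial completely (identity theorem), and descend to `ℍ` as `G'_Φ = 𝒴_Φ(𝕢_L)/s`.

No definitions, no named facts.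

## References

* [CalegariDimitrovTang2025] arXiv:2109.09040, Remark 59; §1 p. 3.
-/

noncomputable section

open Complex Filter Topology Function Metric Set Polynomial
open UpperHalfPlane hiding I
open scoped Real Topology MatrixGroups Manifold Nat

namespace Literature.NumberTheory.Automorphic

namespace ModularLambda

open Literature.NumberTheory.EllipticCurves.JacobiThetaNull
open Literature.NumberTheory.Transcendental.AndreCriterion (coeff_taylor constantCoeff_taylor
  taylor_congr taylor_add taylor_sum taylor_const_mul taylor_mul taylor_one taylor_pow)
open Literature.Analysis.Complex.FormalRoot
open Literature.Analysis.Complex.RootContinuation (exists_holomorphic_root_extend eqOn_of_eqOn_ball)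
open Literature.NumberTheory.ModularForms.QExpansionAlgebra

/-- The Taylor series of `f : ℂ → ℂ` at `0`, as a formal power series (local notation, as in
`AndreCriterionAnalyticProofs`). -/
local notation3 "𝓣[" f "]" =>
  (PowerSeries.mk fun n => ((Nat.factorial n : ℂ)⁻¹ * iteratedDeriv n f 0) : PowerSeries ℂ)

/-! ### Algebraic preliminaries -/

/-- **Scaling the roots**: `[Yⁿ] ∏ᵢ (Y − aᵢ c) = c^{#s − n} [Yⁿ] ∏ᵢ (Y − aᵢ)`. [folklore] -/
theorem coeff_prod_X_sub_C_mul_const {R : Type*} [CommRing R] [Nontrivial R] {ι : Type*}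
    (s : Finset ι) (a : ι → R) (c : R) (n : ℕ) :
    (∏ i ∈ s, (X - C (a i * c))).coeff n = c ^ (s.card - n) * (∏ i ∈ s, (X - C (a i))).coeff n := by
  classical
  induction s using Finset.induction_on generalizing n with
  | empty => simp
  | insert b s hb ih =>
    rw [Finset.prod_insert hb, Finset.prod_insert hb, coeff_X_sub_C_mul', coeff_X_sub_C_mul',
      Finset.card_insert_of_notMem hb, ih n]
    by_cases hn : n ≤ s.card
    · rcases Nat.eq_zero_or_pos n with h0 | hpos
      · subst h0
        simp only [if_true, Nat.sub_zero, pow_succ]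
        ring
      · rw [if_neg hpos.ne', if_neg hpos.ne', ih (n - 1)]
        have h1 : s.card - (n - 1) = (s.card + 1 - n) := by omega
        have h2 : s.card + 1 - n = (s.card - n) + 1 := by omega
        rw [h1, h2, pow_succ]
        ring
    · push Not at hn
      have hdeg : (∏ i ∈ s, (X - C (a i))).natDegree = s.card := natDegree_finsetProd_X_sub_C_eq_card s a
      have hz : (∏ i ∈ s, (X - C (a i))).coeff n = 0 :=
        coeff_eq_zero_of_natDegree_lt (by rw [hdeg]; exact hn)
      rw [hz, mul_zero, mul_zero, sub_zero, mul_zero, sub_zero]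
      split_ifs with h0
      · simp
      · rw [ih (n - 1)]
        rcases (Nat.lt_or_ge (n - 1) (s.card + 1)) with hlt | hge
        · have h1 : n - 1 = s.card := by omega
          have h2 : s.card - (n - 1) = 0 := by omega
          have h3 : s.card + 1 - n = 0 := by omega
          rw [h2, h3]
        · have hz' : (∏ i ∈ s, (X - C (a i))).coeff (n - 1) = 0 :=
            coeff_eq_zero_of_natDegree_lt (by rw [hdeg]; omega)
          rw [hz', mul_zero, mul_zero]

/-- `PowerSeries.map σ` commutes with `aeval`. [folklore] -/
theorem powerSeries_map_aeval (σ : ℂ →+* ℂ) (A : PowerSeries ℂ) (p : ℂ[X]) :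
    PowerSeries.map σ (aeval A p) = aeval (PowerSeries.map σ A) (p.map σ) := by
  refine Polynomial.map_aeval_eq_aeval_map ?_ p A
  ext x
  simp

/-! ### A local inverse of `𝕢_L` at a point of the punctured disc -/

/-- **Local holomorphic branch of `τ = (L/2πi) log q`** at a point `q₀ ≠ 0` of the unit disc:
`θ(q) = τ₀ + (L/2πi) log(q/q₀)` with `𝕢_L(τ₀) = q₀`. [folklore] -/
theorem exists_qParam_localInverse {L : ℝ} (hL : 0 < L) {q₀ : ℂ} (hq₀ : q₀ ∈ ball (0 : ℂ) 1)
    (hq₀0 : q₀ ≠ 0) :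
    ∃ ρ > 0, ∃ θ : ℂ → ℂ, DifferentiableOn ℂ θ (ball q₀ ρ) ∧
      (∀ q ∈ ball q₀ ρ, 0 < (θ q).im ∧ Periodic.qParam L (θ q) = q ∧ q ∈ ball (0 : ℂ) 1) ∧
      θ q₀ = Periodic.invQParam L q₀ := by
  set τ₀ : ℂ := Periodic.invQParam L q₀ with hτ₀
  have hτ₀pos : 0 < τ₀.im :=
    Periodic.im_invQParam_pos_of_norm_lt_one hL (mem_ball_zero_iff.mp hq₀) hq₀0
  have hqτ₀ : Periodic.qParam L τ₀ = q₀ := Periodic.qParam_right_inv hL.ne' hq₀0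
  set θ : ℂ → ℂ := fun q ↦ τ₀ + (L / (2 * π * Complex.I)) * Complex.log (q / q₀) with hθ
  have hθ₀ : θ q₀ = τ₀ := by simp [hθ, div_self hq₀0]
  -- differentiability and the identity `𝕢 (θ q) = q` where `q/q₀ ∈ slitPlane`
  have hslit : ∀ᶠ q in 𝓝 q₀, q / q₀ ∈ slitPlane := by
    have hc : ContinuousAt (fun q : ℂ ↦ q / q₀) q₀ := by fun_prop
    have h1 : (fun q : ℂ ↦ q / q₀) q₀ ∈ slitPlane := by simp [div_self hq₀0]
    exact hc.preimage_mem_nhds (isOpen_slitPlane.mem_nhds h1)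
  have hne : ∀ᶠ q in 𝓝 q₀, q ≠ 0 := isOpen_ne.mem_nhds hq₀0
  have hpos : ∀ᶠ q in 𝓝 q₀, 0 < (θ q).im := by
    have hc : ContinuousAt θ q₀ := by
      have h1 : ContinuousAt (fun q : ℂ ↦ Complex.log (q / q₀)) q₀ :=
        (continuousAt_id.div_const q₀).clog (by simp [div_self hq₀0])
      exact continuousAt_const.add (continuousAt_const.mul h1)
    have := hc.preimage_mem_nhds ((isOpen_lt continuous_const Complex.continuous_im).mem_nhds
      (show θ q₀ ∈ {z : ℂ | 0 < z.im} by rw [hθ₀]; exact hτ₀pos))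
    exact this
  have hball : ∀ᶠ q in 𝓝 q₀, q ∈ ball (0 : ℂ) 1 := isOpen_ball.mem_nhds hq₀
  obtain ⟨ρ, hρ, h⟩ := Metric.eventually_nhds_iff_ball.mp (hslit.and (hne.and (hpos.and hball)))
  refine ⟨ρ, hρ, θ, fun q hq ↦ ?_, fun q hq ↦ ⟨(h q hq).2.2.1, ?_, (h q hq).2.2.2⟩, hθ₀⟩
  · have hs := (h q hq).1
    have hd : DifferentiableAt ℂ θ q :=
      (differentiableAt_const _).add ((differentiableAt_const _).mul
        ((differentiableAt_id.div_const q₀).clog hs))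
    exact hd.differentiableWithinAt
  · obtain ⟨-, hq0, -, -⟩ := h q hq
    have h2pi : (2 * π * Complex.I : ℂ) ≠ 0 := by
      simp [Real.pi_ne_zero, Complex.I_ne_zero]
    have hL0 : (L : ℂ) ≠ 0 := ofReal_ne_zero.mpr hL.ne'
    calc Periodic.qParam L (θ q)
        = cexp (2 * π * Complex.I * τ₀ / L + Complex.log (q / q₀)) := by
          simp only [Periodic.qParam, hθ]
          congr 1
          field_simp
      _ = q₀ * (q / q₀) := by
          rw [Complex.exp_add, Complex.exp_log (div_ne_zero hq0 hq₀0)]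
          simp only [Periodic.qParam] at hqτ₀
          rw [hqτ₀]
      _ = q := mul_div_cancel₀ q hq₀0

/-! ### Packaging a local factorization as a local root system -/

/-- A pointwise factorization `Σₙ bₙ(q) Yⁿ = ∏ᵢ (Y − Yᵢ(q))` on a ball is a local holomorphic
root system in the sense of `RootContinuation.exists_holomorphic_root_extend`. [folklore] -/
theorem local_roots_of_prod_eq {ι : Type*} [Fintype ι] {d : ℕ} {b : ℕ → ℂ → ℂ} {q₀ : ℂ}
    {ε : ℝ} (hε : 0 < ε) {Y : ι → ℂ → ℂ} (hYd : ∀ i, DifferentiableOn ℂ (Y i) (ball q₀ ε))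
    (hfact : ∀ q ∈ ball q₀ ε, (∑ n ∈ Finset.range (d + 1), C (b n q) * X ^ n : ℂ[X]) =
      ∏ i, (X - C (Y i q))) :
    ∃ ε > 0, ∃ (m : ℕ) (Yf : Fin m → ℂ → ℂ),
      (∀ i, DifferentiableOn ℂ (Yf i) (ball q₀ ε)) ∧
      (∀ i, ∀ q ∈ ball q₀ ε, q ∈ ball (0 : ℂ) 1 →
        ∑ n ∈ Finset.range (d + 1), b n q * Yf i q ^ n = 0) ∧
      ∀ q ∈ ball q₀ ε, q ∈ ball (0 : ℂ) 1 → ∀ w : ℂ,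
        ∑ n ∈ Finset.range (d + 1), b n q * w ^ n = 0 → ∃ i, w = Yf i q := by
  classical
  set e := Fintype.equivFin ι with he
  have heval : ∀ q ∈ ball q₀ ε, ∀ w : ℂ,
      ∑ n ∈ Finset.range (d + 1), b n q * w ^ n = ∏ i, (w - Y i q) := by
    intro q hq w
    have := congrArg (fun p : ℂ[X] ↦ p.eval w) (hfact q hq)
    simpa [eval_finsetSum, eval_prod] using this
  refine ⟨ε, hε, Fintype.card ι, fun j ↦ Y (e.symm j), fun j ↦ hYd _, fun j q hq _ ↦ ?_,
    fun q hq _ w hw ↦ ?_⟩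
  · rw [heval q hq]
    exact Finset.prod_eq_zero (Finset.mem_univ (e.symm j)) (sub_self _)
  · rw [heval q hq, Finset.prod_eq_zero_iff] at hw
    obtain ⟨i, -, hi⟩ := hw
    exact ⟨e i, by simp only [Equiv.symm_apply_apply]; exact (sub_eq_zero.mp hi)⟩

/-! ### The main theorem -/

/-- **Complete holomorphic root system of the conjugate polynomial on `ℍ`, with prescribed
expansions at `i∞`.** See the module docstring. Hypotheses: `O` nonempty finite set of holomorphic
`L`-periodic functions on `ℍ`; `𝒫 = Porb` an orbit polynomial for `O` (degree `≤ #O`, top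
coefficient `(X(1−X))^M`, `𝒫(λ(τ), Y) = (λ(1−λ))^M ∏ (Y − Φ(τ))`); `s` a nowhere vanishing
`L`-periodic holomorphic function bounded at `i∞` with rational `q`-expansion such that every
`Φ s` is bounded at `i∞`; `λ` is `L`-periodic with rational expansion; `σ` a field automorphism
of `ℂ`. Conclusion: holomorphic `G'_Φ` (`Φ ∈ O`) with `G'_Φ s` nice,
`qExpansion L (G'_Φ s) = (qExpansion L (Φ s)).map σ`, pairwise distinct, and
`𝒫^σ(λ(τ), Y) = (λ(τ)(1−λ(τ)))^M ∏_Φ (Y − G'_Φ(τ))` on `ℍ`.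
[cite: CalegariDimitrovTang2025, Remark 59 (input: Galois conjugates of modular forms)] -/
theorem exists_conjugate_roots {O : Finset (ℍ → ℂ)} (hO : O.Nonempty)
    (hd : ∀ Φ ∈ O, MDiff Φ) {L : ℝ} (hL : 0 < L)
    (hper : ∀ Φ ∈ O, Periodic (Φ ∘ ofComplex) L)
    {s : ℍ → ℂ} (hs : Periodic (s ∘ ofComplex) L ∧ MDiff s ∧ IsBoundedAtImInfty s)
    (hs0 : ∀ τ, s τ ≠ 0)
    (hsrat : ∀ n, (qExpansion L s).coeff n ∈ Set.range ((↑) : ℚ → ℂ))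
    (hbd : ∀ Φ ∈ O, IsBoundedAtImInfty (Φ * s))
    (hlamper : Periodic ((fun τ : ℍ ↦ modularLambda τ) ∘ ofComplex) L)
    (hlamrat : ∀ n, (qExpansion L (fun τ : ℍ ↦ modularLambda τ)).coeff n ∈ Set.range ((↑) : ℚ → ℂ))
    {M : ℕ} {Porb : Polynomial ℂ[X]}
    (hdeg : Porb.natDegree ≤ O.card) (htop : Porb.coeff O.card = (X * (1 - X)) ^ M)
    (hPorb : ∀ τ : ℍ, Porb.map (evalRingHom (modularLambda τ)) =
      C ((modularLambda τ * (1 - modularLambda τ)) ^ M) * ∏ Φ ∈ O, (X - C (Φ τ)))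
    (σ : ℂ ≃+* ℂ) :
    ∃ G' : (ℍ → ℂ) → ℍ → ℂ, (∀ Φ ∈ O, MDiff (G' Φ)) ∧
      (∀ Φ ∈ O, (Periodic ((G' Φ * s) ∘ ofComplex) L ∧ MDiff (G' Φ * s) ∧
        IsBoundedAtImInfty (G' Φ * s)) ∧
        qExpansion L (G' Φ * s) = PowerSeries.map (σ : ℂ →+* ℂ) (qExpansion L (Φ * s))) ∧
      (∀ Φ ∈ O, ∀ Ψ ∈ O, G' Φ = G' Ψ → Φ = Ψ) ∧
      ∀ τ : ℍ, (Porb.map (mapRingHom (σ : ℂ →+* ℂ))).map (evalRingHom (modularLambda τ)) =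
        C ((modularLambda τ * (1 - modularLambda τ)) ^ M) * ∏ Φ ∈ O, (X - C (G' Φ τ)) := by
  classical
  set d : ℕ := O.card with hdcard
  set σr : ℂ →+* ℂ := (σ : ℂ →+* ℂ) with hσr
  set σh : PowerSeries ℂ →+* PowerSeries ℂ := PowerSeries.map σr with hσh
  set Q : Polynomial ℂ[X] := Porb.map (mapRingHom σr) with hQ
  have hQcoeff : ∀ n, Q.coeff n = (Porb.coeff n).map σr := fun n ↦ by
    rw [hQ, Polynomial.coeff_map, coe_mapRingHom]
  have hσlead : ((X * (1 - X)) ^ M : ℂ[X]).map σr = (X * (1 - X)) ^ M := by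
    simp [Polynomial.map_pow, Polynomial.map_mul, Polynomial.map_sub]
  have hQtop : Q.coeff d = (X * (1 - X)) ^ M := by rw [hQcoeff, hdcard, htop, hσlead]
  have hQdeg : Q.natDegree ≤ d := (natDegree_map_le).trans hdeg
  have hσh_inj : Function.Injective σh := by
    intro p₁ p₂ h
    ext n
    have := congrArg (PowerSeries.coeff n) h
    simp only [hσh, PowerSeries.coeff_map] at this
    exact σ.injective this
  -- ### nice functions on `ℍ`
  set lam : ℍ → ℂ := fun τ ↦ modularLambda τ with hlam
  set leadF : ℍ → ℂ := fun τ ↦ (modularLambda τ * (1 - modularLambda τ)) ^ M with hleadF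
  have hlam_md : MDiff lam := by
    intro τ
    rw [UpperHalfPlane.mdifferentiableAt_iff]
    refine (differentiableAt_modularLambda τ.im_pos).congr_of_eventuallyEq ?_
    filter_upwards [(isOpen_lt continuous_const Complex.continuous_im).mem_nhds τ.im_pos] with z hz
    simp [hlam, ofComplex_apply_of_im_pos hz]
  have hlam_bd : IsBoundedAtImInfty lam := by
    have ht : Tendsto lam atImInfty (𝓝 0) := tendsto_modularLambda.comp tendsto_coe_atImInfty
    exact ht.isBigO_one ℝ
  have hlam_nice : Periodic (lam ∘ ofComplex) L ∧ MDiff lam ∧ IsBoundedAtImInfty lam :=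
    ⟨hlamper, hlam_md, hlam_bd⟩
  have hleadF_eq : leadF = fun τ ↦ ((X * (1 - X)) ^ M : ℂ[X]).eval (lam τ) := by
    funext τ; simp [hleadF, hlam]
  have hleadF_nice : Periodic (leadF ∘ ofComplex) L ∧ MDiff leadF ∧ IsBoundedAtImInfty leadF := by
    rw [hleadF_eq]; exact nice_polynomial_eval _ hlam_nice
  have hleadF_ne : ∀ τ : ℍ, leadF τ ≠ 0 := fun τ ↦
    pow_ne_zero _ (mul_ne_zero (modularLambda_ne_zero τ.im_pos)
      (sub_ne_zero.mpr (Ne.symm (modularLambda_ne_one τ.im_pos))))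
  have hΦs_nice : ∀ Φ ∈ O, Periodic ((Φ * s) ∘ ofComplex) L ∧ MDiff (Φ * s) ∧
      IsBoundedAtImInfty (Φ * s) := fun Φ hΦ ↦
    ⟨by simpa only [Pi.mul_comp] using (hper Φ hΦ).mul hs.1, (hd Φ hΦ).mul hs.2.1, hbd Φ hΦ⟩
  -- ### expansions
  set Λ : PowerSeries ℂ := qExpansion L lam with hΛ
  set S : PowerSeries ℂ := qExpansion L s with hS
  set D : PowerSeries ℂ := qExpansion L leadF with hD
  set Ψ : (ℍ → ℂ) → PowerSeries ℂ := fun Φ ↦ qExpansion L (Φ * s) with hΨ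
  have hD_eq : D = aeval Λ ((X * (1 - X)) ^ M : ℂ[X]) := by
    rw [hD, hleadF_eq, qExpansion_polynomial_eval hL _ hlam_nice]
  have hσΛ : σh Λ = Λ := PowerSeries.map_eq_self_of_forall_coeff_ratCast σr hlamrat
  have hσS : σh S = S := PowerSeries.map_eq_self_of_forall_coeff_ratCast σr hsrat
  have hσD : σh D = D := by
    rw [hD_eq, hσh, powerSeries_map_aeval, ← hσh, hσΛ, hσlead]
  have hD0 : D ≠ 0 := by
    intro h0
    have h1 : leadF = 0 :=
      eq_of_qExpansion_eq hL hleadF_nice (nice_zero L) (by rw [← hD, h0, qExpansion_zero])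
    obtain ⟨τ⟩ : Nonempty ℍ := ⟨UpperHalfPlane.I⟩
    exact hleadF_ne τ (by rw [h1]; rfl)
  -- ### Step B/C: the expansion identity `D * Eₙ = S^{d-n} 𝒫ₙ(Λ)`
  -- coefficient functions of the `s`-scaled monic polynomial and of the plain one
  set e : ℕ → ℍ → ℂ := fun n τ ↦ (C (1 : ℂ) * ∏ Φ ∈ O, (X - C ((Φ * s) τ))).coeff n with he
  have hnice_e : ∀ n, (Periodic (e n ∘ ofComplex) L ∧ MDiff (e n) ∧ IsBoundedAtImInfty (e n)) ∧
      qExpansion L (e n) = (C (1 : PowerSeries ℂ) * ∏ Φ ∈ O, (X - C (Ψ Φ))).coeff n := by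
    intro n
    have h := transform_coeff_C_mul_prod_X_sub_C
      (fun F : ℍ → ℂ ↦ Periodic (F ∘ ofComplex) L ∧ MDiff F ∧ IsBoundedAtImInfty F)
      (fun F ↦ qExpansion L F)
      (fun F G hF hG ↦ ⟨nice_mul hF hG, qExpansion_mul_of_nice hL hF hG⟩)
      (fun F G hF hG ↦ ⟨nice_sub hF hG, qExpansion_sub_of_nice hL hF hG⟩)
      ⟨nice_zero L, qExpansion_zero L⟩ (nice_const 1 L) O (fun Φ hΦ ↦ hΦs_nice Φ hΦ) n
    rw [qExpansion_const 1 hL, PowerSeries.C] at h  -- `C 1 = 1`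
    · exact h
  have hB : ∀ n, ∀ τ : ℍ, leadF τ * e n τ = s τ ^ (d - n) * (Porb.coeff n).eval (lam τ) := by
    intro n τ
    have h1 := congrArg (fun p : ℂ[X] ↦ p.coeff n) (hPorb τ)
    simp only [Polynomial.coeff_map, coe_evalRingHom, coeff_C_mul] at h1
    have h2 : e n τ = s τ ^ (d - n) * (∏ Φ ∈ O, (X - C (Φ τ))).coeff n := by
      simp only [he, map_one, one_mul, Pi.mul_apply, hdcard]
      exact coeff_prod_X_sub_C_mul_const O (fun Φ : ℍ → ℂ ↦ Φ τ) (s τ) n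
    rw [h2, h1]
    simp only [hleadF]
    ring
  have hE1 : ∀ n, D * qExpansion L (e n) = S ^ (d - n) * aeval Λ (Porb.coeff n) := by
    intro n
    have hlhs : (leadF * e n) = fun τ ↦ s τ ^ (d - n) * (Porb.coeff n).eval (lam τ) := by
      funext τ; exact hB n τ
    have hnr : Periodic ((fun τ ↦ (Porb.coeff n).eval (lam τ)) ∘ ofComplex) L ∧
        MDiff (fun τ ↦ (Porb.coeff n).eval (lam τ)) ∧
        IsBoundedAtImInfty (fun τ ↦ (Porb.coeff n).eval (lam τ)) := nice_polynomial_eval _ hlam_nice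
    have hrhs : (fun τ ↦ s τ ^ (d - n) * (Porb.coeff n).eval (lam τ)) =
        (s ^ (d - n)) * fun τ ↦ (Porb.coeff n).eval (lam τ) := by
      funext τ; simp [Pi.mul_apply, Pi.pow_apply]
    rw [hD, ← qExpansion_mul_of_nice hL hleadF_nice (hnice_e n).1, hlhs, hrhs,
      qExpansion_mul_of_nice hL (nice_pow hs _) hnr, qExpansion_pow_of_nice hL hs, hS, hΛ,
      qExpansion_polynomial_eval hL _ hlam_nice]
  -- ### Step D: conjugate identity `D * E'ₙ = S^{d-n} 𝒬ₙ(Λ)`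
  set E' : ℕ → PowerSeries ℂ := fun n ↦ σh (qExpansion L (e n)) with hE'
  have hE'eq : ∀ n, E' n = (C (1 : PowerSeries ℂ) * ∏ Φ ∈ O, (X - C (σh (Ψ Φ)))).coeff n := by
    intro n
    show σh (qExpansion L (e n)) = _
    rw [(hnice_e n).2, ← Polynomial.coeff_map, Polynomial.map_mul, Polynomial.map_C, map_one,
      Polynomial.map_prod]
    congr 2
    refine Finset.prod_congr rfl fun Φ _ ↦ ?_
    rw [Polynomial.map_sub, Polynomial.map_X, Polynomial.map_C]
  have hE2 : ∀ n, D * E' n = S ^ (d - n) * aeval Λ (Q.coeff n) := by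
    intro n
    have h := congrArg σh (hE1 n)
    rw [map_mul, map_mul, map_pow, hσD, hσS, hσh, powerSeries_map_aeval, ← hσh, hσΛ,
      ← hQcoeff] at h
    exact h
  -- ### Step E: the coefficient functions `βₙ` on the disc
  set Nfun : ℕ → ℍ → ℂ := fun n τ ↦ s τ ^ (d - n) * (Q.coeff n).eval (lam τ) with hNfun
  have hNfun_nice : ∀ n, Periodic (Nfun n ∘ ofComplex) L ∧ MDiff (Nfun n) ∧
      IsBoundedAtImInfty (Nfun n) := by
    intro n
    have h1 : Nfun n = (s ^ (d - n)) * fun τ ↦ (Q.coeff n).eval (lam τ) := by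
      funext τ; simp [hNfun, Pi.mul_apply, Pi.pow_apply]
    rw [h1]
    exact nice_mul (nice_pow hs _) (nice_polynomial_eval _ hlam_nice)
  have hNfun_exp : ∀ n, qExpansion L (Nfun n) = D * E' n := by
    intro n
    have h1 : Nfun n = (s ^ (d - n)) * fun τ ↦ (Q.coeff n).eval (lam τ) := by
      funext τ; simp [hNfun, Pi.mul_apply, Pi.pow_apply]
    rw [hE2, h1, qExpansion_mul_of_nice hL (nice_pow hs _) (nice_polynomial_eval _ hlam_nice),
      qExpansion_pow_of_nice hL hs, qExpansion_polynomial_eval hL _ hlam_nice]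
  set Nc : ℕ → ℂ → ℂ := fun n ↦ cuspFunction L (Nfun n) with hNc
  set Dc : ℂ → ℂ := cuspFunction L leadF with hDc
  have hNc_d : ∀ n, DifferentiableOn ℂ (Nc n) (ball 0 1) := fun n ↦
    differentiableOn_cuspFunction_ball hL (hNfun_nice n).1 (hNfun_nice n).2.1 (hNfun_nice n).2.2
  have hDc_d : DifferentiableOn ℂ Dc (ball 0 1) :=
    differentiableOn_cuspFunction_ball hL hleadF_nice.1 hleadF_nice.2.1 hleadF_nice.2.2
  have hT_N : ∀ n, 𝓣[Nc n] = D * E' n := fun n ↦ by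
    rw [← hNfun_exp]; ext m; rw [PowerSeries.coeff_mk, qExpansion_coeff]
  have hT_D : 𝓣[Dc] = D := by
    ext m; rw [PowerSeries.coeff_mk, hD, qExpansion_coeff]
  -- values on the punctured disc / at `𝕢 τ`
  have hq_mem : ∀ τ : ℍ, Periodic.qParam L (τ : ℂ) ∈ ball (0 : ℂ) 1 := fun τ ↦
    mem_ball_zero_iff.mpr (Periodic.norm_qParam_lt_one hL τ.im_pos)
  have hq_ne : ∀ τ : ℍ, Periodic.qParam L (τ : ℂ) ≠ 0 := fun τ ↦ Periodic.qParam_ne_zero _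
  have hNc_val : ∀ n (τ : ℍ), Nc n (Periodic.qParam L τ) = Nfun n τ := fun n τ ↦
    eq_cuspFunction τ hL.ne' (hNfun_nice n).1
  have hDc_val : ∀ τ : ℍ, Dc (Periodic.qParam L τ) = leadF τ := fun τ ↦
    eq_cuspFunction τ hL.ne' hleadF_nice.1
  -- every nonzero point of the disc is `𝕢 τ`
  have hlift : ∀ z ∈ ball (0 : ℂ) 1, z ≠ 0 → ∃ τ : ℍ, Periodic.qParam L τ = z := by
    intro z hz hz0
    refine ⟨⟨Periodic.invQParam L z,
      Periodic.im_invQParam_pos_of_norm_lt_one hL (mem_ball_zero_iff.mp hz) hz0⟩, ?_⟩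
    exact Periodic.qParam_right_inv hL.ne' hz0
  have hDc_ne : ∀ z ∈ ball (0 : ℂ) 1, z ≠ 0 → Dc z ≠ 0 := by
    intro z hz hz0
    obtain ⟨τ, rfl⟩ := hlift z hz hz0
    rw [hDc_val]
    exact hleadF_ne τ
  -- holomorphic division near `0` and the global `βₙ`
  have hdiv : ∀ n, ∃ ε > 0, ε ≤ 1 ∧ ∃ b : ℂ → ℂ, DifferentiableOn ℂ b (ball 0 ε) ∧
      (∀ z ∈ ball (0 : ℂ) ε, Dc z ≠ 0 ∨ z = 0) ∧ (∀ z ∈ ball (0 : ℂ) ε, Nc n z = Dc z * b z) ∧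
      𝓣[b] = E' n := fun n ↦
    exists_eq_mul_of_taylor_eq_mul one_pos (hNc_d n) hDc_d (by rw [hT_D]; exact hD0)
      (E := E' n) (by rw [hT_N, hT_D])
  choose εb hεb hεb1 b hbd hbD hbeq hbT using hdiv
  set β : ℕ → ℂ → ℂ := fun n z ↦ if z = 0 then b n 0 else Nc n z / Dc z with hβ
  have hβ_loc : ∀ n, β n =ᶠ[𝓝 0] b n := by
    intro n
    filter_upwards [ball_mem_nhds (0 : ℂ) (hεb n)] with z hz
    by_cases hz0 : z = 0
    · simp [hβ, hz0]
    · rw [hβ]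
      simp only [if_neg hz0]
      have hD' : Dc z ≠ 0 := (hbD n z hz).resolve_right hz0
      rw [hbeq n z hz]
      field_simp
  have hβ_d : ∀ n, DifferentiableOn ℂ (β n) (ball 0 1) := by
    intro n z hz
    by_cases hz0 : z = 0
    · subst hz0
      have hb0 : DifferentiableAt ℂ (b n) 0 := (hbd n).differentiableAt (ball_mem_nhds 0 (hεb n))
      exact (hb0.congr_of_eventuallyEq (hβ_loc n)).differentiableWithinAt
    · have hev : β n =ᶠ[𝓝 z] fun w ↦ Nc n w / Dc w := by
        filter_upwards [isOpen_ne.mem_nhds hz0] with w hw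
        simp [hβ, hw]
      have h1 : DifferentiableAt ℂ (fun w ↦ Nc n w / Dc w) z :=
        ((hNc_d n).differentiableAt (isOpen_ball.mem_nhds hz)).div
          (hDc_d.differentiableAt (isOpen_ball.mem_nhds hz)) (hDc_ne z hz hz0)
      exact (h1.congr_of_eventuallyEq hev).differentiableWithinAt
  have hβ_T : ∀ n, 𝓣[β n] = E' n := fun n ↦ by rw [taylor_congr (hβ_loc n), hbT]
  have hβ_val : ∀ n (τ : ℍ), β n (Periodic.qParam L τ) = Nfun n τ / leadF τ := by
    intro n τ
    rw [hβ]
    simp only [if_neg (hq_ne τ), hNc_val, hDc_val]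
  -- ### Step F: the coefficient family with top coefficient `1` and the root system at `0`
  set bb : ℕ → ℂ → ℂ := fun n z ↦ if n < d then β n z else if n = d then 1 else 0 with hbb
  have hbb_lt : ∀ n, n < d → bb n = β n := fun n hn ↦ by funext z; simp [hbb, hn]
  have hbb_d : bb d = fun _ ↦ 1 := by funext z; simp [hbb]
  have hbb_diff : ∀ n ∈ Finset.range (d + 1), DifferentiableOn ℂ (bb n) (ball 0 1) := by
    intro n hn
    rcases Nat.lt_or_ge n d with h | h
    · rw [hbb_lt n h]; exact hβ_d n
    · have : n = d := by have := Finset.mem_range.mp hn; omega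
      subst this; rw [hbb_d]; exact differentiableOn_const _
  have hbb_d0 : bb d 0 ≠ 0 := by rw [hbb_d]; exact one_ne_zero
  -- the formal roots at the cusp
  haveI : Nonempty O := hO.coe_sort
  set r : O → PowerSeries ℂ := fun Φ ↦ σh (Ψ Φ) with hr
  have hΨinj : ∀ Φ ∈ O, ∀ Φ' ∈ O, Ψ Φ = Ψ Φ' → Φ = Φ' := by
    intro Φ hΦ Φ' hΦ' h
    have h1 : Φ * s = Φ' * s := eq_of_qExpansion_eq hL (hΦs_nice Φ hΦ) (hΦs_nice Φ' hΦ') h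
    funext τ
    have := congrFun h1 τ
    simp only [Pi.mul_apply] at this
    exact mul_right_cancel₀ (hs0 τ) this
  have hrinj : Function.Injective r := fun Φ Φ' h ↦
    Subtype.ext (hΨinj Φ Φ.2 Φ' Φ'.2 (hσh_inj h))
  have hcardO : Fintype.card O = d := Fintype.card_coe O
  have hmonic_deg : (∏ Φ : O, (X - C (r Φ)) : Polynomial (PowerSeries ℂ)).natDegree = d := by
    rw [natDegree_finsetProd_X_sub_C_eq_card, Finset.card_univ, hcardO]
  have hfact0 : ∀ n ∈ Finset.range (d + 1),
      𝓣[bb n] = (C 𝓣[bb d] * ∏ Φ : O, (X - C (r Φ))).coeff n := by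
    intro n hn
    have hTd : 𝓣[bb d] = 1 := by
      rw [hbb_d]
      have : (fun _ : ℂ ↦ (1 : ℂ)) = (1 : ℂ → ℂ) := rfl
      rw [this, Literature.NumberTheory.Transcendental.AndreCriterion.taylor_one]
    rw [hTd, map_one, one_mul]
    rcases Nat.lt_or_ge n d with h | h
    · rw [hbb_lt n h, hβ_T n, hE'eq n, map_one, one_mul, ← Finset.prod_coe_sort O]
    · have : n = d := by have := Finset.mem_range.mp hn; omega
      subst this
      rw [hTd]
      have hm := (monic_prod_X_sub_C (fun Φ : O ↦ r Φ) Finset.univ).coeff_natDegree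
      rw [hmonic_deg] at hm
      exact hm.symm
  obtain ⟨ε₀, hε₀, hε₀1, y0, hy0d, hy0T, hy0fact⟩ :=
    exists_local_roots_of_taylor_factorization hcardO one_pos hbb_diff hbb_d0 hrinj hfact0
  -- ### the polynomial family on the disc
  set poly : ℂ → ℂ[X] := fun z ↦ ∑ n ∈ Finset.range (d + 1), C (bb n z) * X ^ n with hpoly
  have hpoly0 : ∀ z ∈ ball (0 : ℂ) ε₀, poly z = ∏ Φ : O, (X - C (y0 Φ z)) := by
    intro z hz
    simp only [hpoly]
    rw [hy0fact z hz, hbb_d]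
    simp
  -- ### Step G: local root systems at every point of the disc
  have hloc : ∀ q₀ ∈ ball (0 : ℂ) 1, ∃ ε > 0, ∃ (m : ℕ) (Yf : Fin m → ℂ → ℂ),
      (∀ i, DifferentiableOn ℂ (Yf i) (ball q₀ ε)) ∧
      (∀ i, ∀ q ∈ ball q₀ ε, q ∈ ball (0 : ℂ) 1 →
        ∑ n ∈ Finset.range (d + 1), bb n q * Yf i q ^ n = 0) ∧
      ∀ q ∈ ball q₀ ε, q ∈ ball (0 : ℂ) 1 → ∀ w : ℂ,
        ∑ n ∈ Finset.range (d + 1), bb n q * w ^ n = 0 → ∃ i, w = Yf i q := by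
    intro q₀ hq₀
    by_cases hq₀0 : q₀ = 0
    · subst hq₀0
      exact local_roots_of_prod_eq hε₀ hy0d hpoly0
    · -- a point `τ₀` over `q₀`, local roots of `𝒬` at `a' = λ τ₀`, and the branch `θ`
      obtain ⟨ρ, hρ, θ, hθd, hθ, hθ₀⟩ := exists_qParam_localInverse hL hq₀ hq₀0
      set τ₀ : ℍ := ⟨θ q₀, (hθ q₀ (mem_ball_self hρ)).1⟩ with hτ₀
      have ha'0 : modularLambda (τ₀ : ℂ) ≠ 0 := modularLambda_ne_zero τ₀.im_pos
      have ha'1 : modularLambda (τ₀ : ℂ) ≠ 1 := modularLambda_ne_one τ₀.im_pos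
      obtain ⟨ε₁, hε₁, yc, hycd, hycfact0⟩ :=
        exists_local_roots_conjugate hO hd hdeg htop hPorb σ ha'0 ha'1
      have hycfact : ∀ t ∈ ball (0 : ℂ) ε₁, Q.map (evalRingHom (modularLambda (τ₀ : ℂ) + t)) =
          C (((modularLambda (τ₀ : ℂ) + t) * (1 - (modularLambda (τ₀ : ℂ) + t))) ^ M) *
            ∏ Φ ∈ O, (X - C (yc Φ t)) := fun t ht ↦ by
        simpa only [hQ, hσr] using hycfact0 t ht
      set a' : ℂ := modularLambda (τ₀ : ℂ) with ha'
      -- the composite maps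
      set tfun : ℂ → ℂ := fun q ↦ modularLambda (θ q) - a' with htfun
      have hopen : IsOpen {z : ℂ | 0 < z.im} := isOpen_lt continuous_const Complex.continuous_im
      have hθcont : ContinuousAt θ q₀ := (hθd.differentiableAt (ball_mem_nhds q₀ hρ)).continuousAt
      have htcont : ContinuousAt tfun q₀ := by
        have h1 : ContinuousAt (fun q ↦ modularLambda (θ q)) q₀ :=
          ContinuousAt.comp (differentiableAt_modularLambda (hθ q₀ (mem_ball_self hρ)).1).continuousAt
            hθcont
        exact h1.sub continuousAt_const
      have ht0 : tfun q₀ = 0 := by simp [htfun, ha', hτ₀]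
      have hsmall : ∀ᶠ q in 𝓝 q₀, tfun q ∈ ball (0 : ℂ) ε₁ := by
        have := htcont.preimage_mem_nhds (isOpen_ball.mem_nhds (by rw [ht0]; exact mem_ball_self hε₁))
        exact this
      have hballρ : ∀ᶠ q in 𝓝 q₀, q ∈ ball q₀ ρ := ball_mem_nhds q₀ hρ
      obtain ⟨ε₂, hε₂, hε₂prop⟩ := Metric.eventually_nhds_iff_ball.mp (hsmall.and hballρ)
      -- the local roots `Y Φ q = s(θ q) · yc Φ (λ(θ q) − a')`
      set Yl : O → ℂ → ℂ := fun Φ q ↦ s (ofComplex (θ q)) * yc Φ (tfun q) with hYl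
      have hs_diff : DifferentiableOn ℂ (fun z : ℂ ↦ s (ofComplex z)) {z : ℂ | 0 < z.im} :=
        UpperHalfPlane.mdifferentiable_iff.mp hs.2.1
      have hYld : ∀ Φ : O, DifferentiableOn ℂ (Yl Φ) (ball q₀ ε₂) := by
        intro Φ q hq
        obtain ⟨htq, hqρ⟩ := hε₂prop q hq
        have hθq := hθ q hqρ
        have hθdq : DifferentiableAt ℂ θ q := hθd.differentiableAt (isOpen_ball.mem_nhds hqρ)
        have h1 : DifferentiableAt ℂ (fun w ↦ s (ofComplex (θ w))) q :=
          (hs_diff.differentiableAt (hopen.mem_nhds hθq.1)).comp q hθdq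
        have h2 : DifferentiableAt ℂ tfun q :=
          ((differentiableAt_modularLambda hθq.1).comp q hθdq).sub_const _
        have h3 : DifferentiableAt ℂ (fun w ↦ yc Φ (tfun w)) q :=
          ((hycd Φ Φ.2).differentiableAt (isOpen_ball.mem_nhds htq)).comp q h2
        exact (h1.mul h3).differentiableWithinAt
      have hYlfact : ∀ q ∈ ball q₀ ε₂, poly q = ∏ Φ : O, (X - C (Yl Φ q)) := by
        intro q hq
        obtain ⟨htq, hqρ⟩ := hε₂prop q hq
        obtain ⟨hθpos, hθq, hq1⟩ := hθ q hqρ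
        set τ : ℍ := ⟨θ q, hθpos⟩ with hτ
        have hqτ : Periodic.qParam L (τ : ℂ) = q := hθq
        have hlamτ : modularLambda (τ : ℂ) = a' + tfun q := by simp [htfun, hτ]
        -- coefficients of `poly q`
        have hcoeff_poly : ∀ n, (poly q).coeff n = if n ∈ Finset.range (d + 1) then bb n q else 0 := by
          intro n
          simp only [hpoly, finsetSum_coeff, coeff_C_mul_X_pow]
          rw [Finset.sum_ite_eq]
        have hbbq : ∀ n ∈ Finset.range (d + 1),
            bb n q = s τ ^ (d - n) * (Q.coeff n).eval (modularLambda (τ : ℂ)) / leadF τ := by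
          intro n hn
          rcases Nat.lt_or_ge n d with h | h
          · rw [hbb_lt n h, ← hqτ, hβ_val n τ]
          · have : n = d := by have := Finset.mem_range.mp hn; omega
            subst this
            rw [hbb_d, hQtop]
            simp only [Nat.sub_self, pow_zero, one_mul, eval_pow, eval_mul, eval_sub, eval_one, eval_X]
            rw [div_self (hleadF_ne τ)]
        -- the factorization of `𝒬 (λ τ, ·)` from part I
        have hQfact := hycfact (tfun q) htq
        rw [← hlamτ] at hQfact
        have hcoeff_Q : ∀ n, (Q.coeff n).eval (modularLambda (τ : ℂ)) =
            leadF τ * (∏ Φ ∈ O, (X - C (yc Φ (tfun q)))).coeff n := by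
          intro n
          have := congrArg (fun p : ℂ[X] ↦ p.coeff n) hQfact
          simp only [Polynomial.coeff_map, coe_evalRingHom, coeff_C_mul] at this
          rw [this]
        apply Polynomial.ext
        intro n
        rw [hcoeff_poly n]
        by_cases hn : n ∈ Finset.range (d + 1)
        · rw [if_pos hn, hbbq n hn, hcoeff_Q n, ← Finset.prod_coe_sort O]
          have hsc := coeff_prod_X_sub_C_mul_const (Finset.univ : Finset O)
            (fun Φ : O ↦ yc Φ (tfun q)) (s τ) n
          rw [Finset.card_univ, hcardO] at hsc
          have hYl' : ∀ Φ : O, Yl Φ q = yc Φ (tfun q) * s τ := fun Φ ↦ by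
            simp only [hYl, hτ, ofComplex_apply_of_im_pos hθpos]; ring
          simp only [hYl']
          rw [hsc, mul_div_assoc, mul_div_cancel_left₀ _ (hleadF_ne τ)]
        · rw [if_neg hn]
          have hn' : d < n := by rw [Finset.mem_range] at hn; omega
          rw [coeff_eq_zero_of_natDegree_lt]
          rw [natDegree_finsetProd_X_sub_C_eq_card, Finset.card_univ, hcardO]
          exact hn'
      exact local_roots_of_prod_eq hε₂ hYld hYlfact
  -- ### Step H: continuation of the roots to the whole disc
  have hy0root : ∀ Φ : O, ∀ q ∈ ball (0 : ℂ) ε₀,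
      ∑ n ∈ Finset.range (d + 1), bb n q * y0 Φ q ^ n = 0 := by
    intro Φ q hq
    have := congrArg (fun p : ℂ[X] ↦ p.eval (y0 Φ q)) (hpoly0 q hq)
    simp only [hpoly, eval_finsetSum, eval_mul, eval_C, eval_pow, eval_X, eval_prod, eval_sub] at this
    rw [this]
    exact Finset.prod_eq_zero (Finset.mem_univ Φ) (sub_self _)
  have hext : ∀ Φ : O, ∃ 𝒴 : ℂ → ℂ, DifferentiableOn ℂ 𝒴 (ball 0 1) ∧
      (∀ q ∈ ball (0 : ℂ) 1, ∑ n ∈ Finset.range (d + 1), bb n q * 𝒴 q ^ n = 0) ∧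
      ∀ q ∈ ball (0 : ℂ) ε₀, 𝒴 q = y0 Φ q := fun Φ ↦
    exists_holomorphic_root_extend hloc hε₀ hε₀1 (hy0d Φ) (hy0root Φ)
  choose 𝒴 h𝒴d h𝒴root h𝒴eq using hext
  -- ### Step I: complete factorization on the disc
  have hfactor : ∀ z ∈ ball (0 : ℂ) 1, poly z = ∏ Φ : O, (X - C (𝒴 Φ z)) := by
    have hcoef : ∀ m, EqOn (fun z ↦ (poly z).coeff m - (C (1 : ℂ) * ∏ Φ : O, (X - C (𝒴 Φ z))).coeff m)
        (fun _ ↦ 0) (ball 0 1) := by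
      intro m
      refine eqOn_of_eqOn_ball hε₀ ?_ (differentiableOn_const _) fun z hz ↦ ?_
      · refine DifferentiableOn.sub ?_ ?_
        · have : (fun z ↦ (poly z).coeff m) = fun z ↦ if m ∈ Finset.range (d + 1) then bb m z else 0 := by
            funext z
            simp only [hpoly, finsetSum_coeff, coeff_C_mul_X_pow]
            rw [Finset.sum_ite_eq]
          rw [this]
          split_ifs with hm
          · exact hbb_diff m hm
          · exact differentiableOn_const _
        · exact differentiableOn_coeff_C_mul_prod_X_sub_C (differentiableOn_const _) Finset.univ
            (fun Φ _ ↦ h𝒴d Φ) m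
      · rw [hpoly0 z hz, map_one, one_mul, sub_eq_zero]
        congr 1
        exact Finset.prod_congr rfl fun Φ _ ↦ by rw [h𝒴eq Φ z hz]
    intro z hz
    apply Polynomial.ext
    intro m
    have := hcoef m hz
    simp only [map_one, one_mul, sub_eq_zero] at this
    exact this
  -- ### Step J: back to `ℍ`
  set G' : (ℍ → ℂ) → ℍ → ℂ := fun Φ τ ↦
    if h : Φ ∈ O then 𝒴 ⟨Φ, h⟩ (Periodic.qParam L τ) / s τ else 0 with hG'
  have hG's : ∀ Φ (hΦ : Φ ∈ O), G' Φ * s = fun τ : ℍ ↦ 𝒴 ⟨Φ, hΦ⟩ (Periodic.qParam L τ) := by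
    intro Φ hΦ
    funext τ
    simp only [hG', Pi.mul_apply, dif_pos hΦ]
    field_simp [hs0 τ]
  have hcomp : ∀ Φ : O, (Periodic ((fun τ : ℍ ↦ 𝒴 Φ (Periodic.qParam L τ)) ∘ ofComplex) L ∧
      MDiff (fun τ : ℍ ↦ 𝒴 Φ (Periodic.qParam L τ)) ∧
      IsBoundedAtImInfty (fun τ : ℍ ↦ 𝒴 Φ (Periodic.qParam L τ))) ∧
      qExpansion L (fun τ : ℍ ↦ 𝒴 Φ (Periodic.qParam L τ)) = 𝓣[𝒴 Φ] := by
    intro Φ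
    obtain ⟨hn, -, hexp⟩ := nice_comp_qParam (h𝒴d Φ) hL
    exact ⟨hn, hexp⟩
  have hTY : ∀ Φ : O, 𝓣[𝒴 Φ] = r Φ := by
    intro Φ
    rw [← hy0T Φ]
    apply taylor_congr
    filter_upwards [ball_mem_nhds (0 : ℂ) hε₀] with z hz using h𝒴eq Φ z hz
  refine ⟨G', fun Φ hΦ ↦ ?_, fun Φ hΦ ↦ ?_, fun Φ hΦ Ψ' hΨ' heq ↦ ?_, fun τ ↦ ?_⟩
  · -- holomorphy of `G' Φ`
    have h1 : MDiff (G' Φ * s) := by rw [hG's Φ hΦ]; exact (hcomp ⟨Φ, hΦ⟩).1.2.1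
    have hA : DifferentiableOn ℂ ((G' Φ * s) ∘ ofComplex) {z : ℂ | 0 < z.im} :=
      UpperHalfPlane.mdifferentiable_iff.mp h1
    have hB : DifferentiableOn ℂ (s ∘ ofComplex) {z : ℂ | 0 < z.im} :=
      UpperHalfPlane.mdifferentiable_iff.mp hs.2.1
    have hC : (G' Φ) ∘ ofComplex = fun z ↦ ((G' Φ * s) ∘ ofComplex) z / (s ∘ ofComplex) z := by
      funext z
      simp only [comp_apply, Pi.mul_apply]
      field_simp [hs0 (ofComplex z)]
    refine UpperHalfPlane.mdifferentiable_iff.mpr ?_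
    rw [hC]
    exact hA.div hB fun z _ ↦ hs0 _
  · rw [hG's Φ hΦ]
    exact ⟨(hcomp ⟨Φ, hΦ⟩).1, by rw [(hcomp ⟨Φ, hΦ⟩).2, hTY]⟩
  · -- distinctness
    have h1 : r ⟨Φ, hΦ⟩ = r ⟨Ψ', hΨ'⟩ := by
      rw [← hTY ⟨Φ, hΦ⟩, ← hTY ⟨Ψ', hΨ'⟩, ← (hcomp ⟨Φ, hΦ⟩).2, ← (hcomp ⟨Ψ', hΨ'⟩).2,
        ← hG's Φ hΦ, ← hG's Ψ' hΨ', heq]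
    exact congrArg Subtype.val (hrinj h1)
  · -- the factorization on `ℍ`
    have hz := hq_mem τ
    have hfz := hfactor _ hz
    have hcoeff_poly : ∀ n, (poly (Periodic.qParam L τ)).coeff n =
        if n ∈ Finset.range (d + 1) then bb n (Periodic.qParam L τ) else 0 := by
      intro n
      simp only [hpoly, finsetSum_coeff, coeff_C_mul_X_pow]
      rw [Finset.sum_ite_eq]
    have hbbq : ∀ n ∈ Finset.range (d + 1), bb n (Periodic.qParam L τ) =
        s τ ^ (d - n) * (Q.coeff n).eval (modularLambda (τ : ℂ)) / leadF τ := by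
      intro n hn
      rcases Nat.lt_or_ge n d with h | h
      · rw [hbb_lt n h, hβ_val n τ]
      · have : n = d := by have := Finset.mem_range.mp hn; omega
        subst this
        rw [hbb_d, hQtop]
        simp only [Nat.sub_self, pow_zero, one_mul, eval_pow, eval_mul, eval_sub, eval_one, eval_X]
        rw [div_self (hleadF_ne τ)]
    have hG'val : ∀ Φ : O, 𝒴 Φ (Periodic.qParam L τ) = G' Φ τ * s τ := fun Φ ↦ by
      have := congrFun (hG's Φ Φ.2) τ
      simp only [Pi.mul_apply] at this
      exact this.symm
    apply Polynomial.ext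
    intro n
    rw [Polynomial.coeff_map, coe_evalRingHom, coeff_C_mul]
    by_cases hn : n ∈ Finset.range (d + 1)
    · rw [← Finset.prod_coe_sort O]
      have hsc := coeff_prod_X_sub_C_mul_const (Finset.univ : Finset O)
        (fun Φ : O ↦ G' Φ τ) (s τ) n
      rw [Finset.card_univ, hcardO] at hsc
      have hs' : s τ ^ (d - n) ≠ 0 := pow_ne_zero _ (hs0 τ)
      have key : s τ ^ (d - n) * ((Q.coeff n).eval (modularLambda (τ : ℂ)) / leadF τ) =
          s τ ^ (d - n) * (∏ i : O, (X - C (G' i τ))).coeff n := by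
        rw [← mul_div_assoc, ← hbbq n hn]
        have h1 := congrArg (fun p : ℂ[X] ↦ p.coeff n) hfz
        simp only [hcoeff_poly n, if_pos hn] at h1
        rw [h1]
        simp only [hG'val]
        exact hsc
      have h2 : (Q.coeff n).eval (modularLambda (τ : ℂ)) / leadF τ =
          (∏ i : O, (X - C (G' i τ))).coeff n := mul_left_cancel₀ hs' key
      rw [(div_eq_iff (hleadF_ne τ)).mp h2, mul_comm]
    · have hn' : d < n := by rw [Finset.mem_range] at hn; omega
      rw [coeff_eq_zero_of_natDegree_lt (hQdeg.trans_lt hn'), coeff_eq_zero_of_natDegree_lt,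
        mul_zero, eval_zero]
      rw [natDegree_finsetProd_X_sub_C_eq_card]
      exact hn'

end ModularLambda

end Literature.NumberTheory.Automorphic
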